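import Summits.BirchSwinnertonDyer.BirchSwinnertonDyer.Theorems.ByReductionTypeAtTwoOrdKatoHalfAtTwoIsoPosDiscNecessity
import Summits.BirchSwinnertonDyer.BirchSwinnertonDyer.Theorems.ByReductionTypeAtTwoOrdKatoHalfAtTwoIsoGreenbergMuDefs
import Summits.BirchSwinnertonDyer.BirchSwinnertonDyer.Theorems.ByReductionTypeAtTwoOrdKatoHalfAtTwoIsoHintOfAbbesUllmo
import Summits.BirchSwinnertonDyer.Rank1Residual.X5.KatoOrdTwoMuPart
import Literature.NumberTheory.EllipticCurves.NonEisensteinPrimeOfSurjective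
import Literature.NumberTheory.EllipticCurves.IsogenyIdProofs
import Literature.Uncategorized.OrdPublishedInputsAtTwo
import HarnessLib

/-!
# Cert48d — crux-triage r1 seat 1, GEN 48: the DIRECT ROAD IS SIGN-FREE ⇒ on the ONTO cell the crux is EQUIVALENT to
# Greenberg's `μ₂ = 0` on the habitat (both signs of `Δ`), modulo {PUB, Abbes–Ullmo, Cassels} — kernel, by LANDED and BUILT names.

Pre-vet by name of w3 GEN 7's announced §4 (draft `MuFreeValueNegOfGreenbergMu.lean`, HOME folder `cruxlead19573-w3-g7`, unproposed;
its import chain contains the UNBUILT p734050 module — this file avoids it). Finding F-48d of `TRIAGE-r1-1.md`: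
* `cruxOnto_of_g11Habitat` — G11|habitat (sign-free Greenberg μ₂ = 0 on the non-CM, r_an = 0, good-ordinary, ρ̄₂-onto locus) +
  Abbes–Ullmo + Kato 17.4 (1)(2)@2 ⟹ the crux ON THE ONTO CELL with `W' := W`, through the three landed doors
  `O1.katoMuPartAtTwo_of_mu_eq_zero` → `O1.mainConjectureLowerDivisibilityAtTwoOrd_of_katoMuPartAtTwo` (+ `hint_two_of_abbesUllmo_of_irr`)
  → `isIsogenous_self`: NO sign hypothesis is used anywhere (GEN 47's `Cert47s1a` passed `0 < Δ` only into G11⁺'s own binder).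
* `g11Habitat_of_cruxOnto` — the converse (v24 §4 `greenbergMu_two_onto_necessary`, replayed by landed names: isogeny invariance
  `IsogenyMuShift.katoHalf_isogenyInvariant`, `O1.katoMuPartAtTwo_of_mainConjectureLowerDivisibilityAtTwoOrd`, `mu_eq_zero_of_katoMuPartAtTwo_of_irr`).
* `cruxOnto_iff_g11Habitat` — **crux|onto ⟺ G11|habitat** modulo {PUB, AU, Cassels}; `g11Habitat_of_pos_and_neg` — G11⁺ (landed p733065,
  by name) ∧ G11⁻ (w3's draft text VERBATIM, rank-free) ⟹ G11|habitat; `crux_of_onto_and_notOnto` — the route decl `OrdKatoHalfAtTwoIso`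
  (BY NAME) from the onto-cell text and the not-onto-cell text (23921's road, displayed abstractly).
CONSEQUENCE (pricing, not a grade): on the onto cell the registered Δ<0 apparatus {`stub_tateDualityTower`, `stub_ordKernelFunctional`,
`stub_muFreeValue_negDisc_two`} is NOT needed for the CRUX — only for producing child 24097's conjunct-1 text F1μι⁻; a v25 = {G11⁺, G11⁻ (or one
sign-free G11|habitat), bundle, R-opt∃♭, FW, lemma46} closes the crux decl with the onto cell priced as ONE published conjecture (Greenberg 1.11 at 2),
necessary and sufficient mod print. BSD is not proved by any of this; the crux is not proved; every theorem is conditional on its displayed hypotheses.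
-/

set_option autoImplicit false
set_option linter.dupNamespace false

noncomputable section

open scoped Classical MatrixGroups ModularForm NumberField
open CongruenceSubgroup WeierstrassCurve Field IsDedekindDomain NumberField
open Literature.NumberTheory.GaloisRepresentations
open Literature.NumberTheory.GaloisCohomology
open Literature.NumberTheory.EllipticCurves Literature.NumberTheory.EllipticCurves.ModularForms
  Literature.NumberTheory.EllipticCurves.GreenbergSelmer
open Literature.NumberTheory.EllipticCurves.Kato2004
open Literature.NumberTheory.EllipticCurves.IwasawaDual
open Literature.NumberTheory.EllipticCurves.Rank1Residual
open Literature.NumberTheory.EllipticCurves.Greenberg1999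
open Summit.BirchSwinnertonDyer.Rank1Residual Summit.BirchSwinnertonDyer.Rank1Residual.X5
open Summit.BirchSwinnertonDyer.BirchSwinnertonDyer.Theorems.SteinbergFibreAtTwo
open Summit.BirchSwinnertonDyer.BirchSwinnertonDyer.Theses.ByReductionTypeAtTwo

namespace Summit.BirchSwinnertonDyer.BirchSwinnertonDyer.Cruxes.OrdKatoHalfAtTwoIso.TriageCert48d

/-- **G11|habitat, SIGN-FREE**: Greenberg's `μ₂(X(W/ℚ_∞)) = 0` for every normalised cyclotomic dual datum of every non-CM,
analytic-rank-0, good-ordinary-at-2 `W` with `ρ̄_{W,2}` onto — BOTH signs of `Δ`. Displayed as a hypothesis; nothing asserted.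
[cite: GreenbergLNM1716, Conj. 1.11 (p. 64)] -/
def G11HabitatText : Prop :=
  ∀ (W : WeierstrassCurve ℚ) [W.IsElliptic] [W.IsGloballyMinimal], ¬ W.HasCM → W.analyticRank = 0 → GoodOrd W 2 →
    W.HasSurjectiveModNGaloisRep 2 → ∀ (κ : ZpExtension ℚ 2) (γ : absoluteGaloisGroup ℚ),
      κ.IsCyclotomic → κ.IsTopGenerator γ → IsCyclotomicVariable 2 γ → ∀ D : W.SelmerDualData κ γ, D.mu = 0

/-- **w3 GEN 7's G11⁻ text VERBATIM** (draft `GreenbergMuNegDefs.lean` :67, `GreenbergMuZeroTwoOrdNegDisc`; rank-free, CM-free).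
Displayed as a hypothesis; nothing asserted. [cite: GreenbergLNM1716, Conj. 1.11 (p. 64)] -/
def G11NegText : Prop :=
  ∀ (W : WeierstrassCurve ℚ) [W.IsElliptic] [W.IsGloballyMinimal],
    GoodOrd W 2 → W.HasSurjectiveModNGaloisRep 2 → W.Δ < 0 →
    ∀ (κ : ZpExtension ℚ 2) (γ : absoluteGaloisGroup ℚ), κ.IsCyclotomic → κ.IsTopGenerator γ → IsCyclotomicVariable 2 γ →
      ∀ D : W.SelmerDualData κ γ, D.mu = 0

/-- **The crux `OrdKatoHalfAtTwoIso` RESTRICTED TO THE ONTO CELL** (its body verbatim with `W.HasSurjectiveModNGaloisRep 2 →` inserted). -/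
def CruxOntoText : Prop :=
  ∀ (W : WeierstrassCurve ℚ) [W.IsElliptic] [W.IsGloballyMinimal], ¬ W.HasCM → W.analyticRank = 0 → GoodOrd W 2 →
    W.HasSurjectiveModNGaloisRep 2 →
    ∃ (W' : WeierstrassCurve ℚ) (_ : W'.IsElliptic) (_ : W'.IsGloballyMinimal),
      IsIsogenous W W' ∧ O1.MainConjectureLowerDivisibilityAtTwoOrd W'

/-- **The crux RESTRICTED TO THE NOT-ONTO CELL** (23921's B7′ road closes this; displayed abstractly). -/
def CruxNotOntoText : Prop :=
  ∀ (W : WeierstrassCurve ℚ) [W.IsElliptic] [W.IsGloballyMinimal], ¬ W.HasCM → W.analyticRank = 0 → GoodOrd W 2 →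
    ¬ W.HasSurjectiveModNGaloisRep 2 →
    ∃ (W' : WeierstrassCurve ℚ) (_ : W'.IsElliptic) (_ : W'.IsGloballyMinimal),
      IsIsogenous W W' ∧ O1.MainConjectureLowerDivisibilityAtTwoOrd W'

/-- G11⁺ (the LANDED def p733065, by name) ∧ G11⁻ (w3's text) ⟹ G11|habitat; `Δ ≠ 0` for an elliptic curve. [folklore] -/
theorem g11Habitat_of_pos_and_neg (hP : GreenbergMuZeroTwoOrdPosDisc) (hN : G11NegText) : G11HabitatText := by
  intro W _ _ hcm hr hgo h2 κ γ hκ hγ hγ' D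
  rcases lt_trichotomy W.Δ 0 with hΔ | hΔ | hΔ
  · exact hN W hgo h2 hΔ κ γ hκ hγ hγ' D
  · exact absurd hΔ W.isUnit_Δ.ne_zero
  · exact hP W hcm hr hgo h2 hΔ κ γ hκ hγ hγ' D

/-- Conversely G11|habitat gives back G11⁺ by name (G11⁻'s off-habitat part — positive rank / CM — is of course not recovered). [folklore] -/
theorem g11Pos_of_g11Habitat (h : G11HabitatText) : GreenbergMuZeroTwoOrdPosDisc :=
  fun W _ _ hcm hr hgo h2 _ κ γ hκ hγ hγ' D => h W hcm hr hgo h2 κ γ hκ hγ hγ' D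

/-- **DIRECT ROAD, SIGN-FREE — line 1: G11|habitat ⟹ Kato's `μ`-part at every curve of the onto cell.**
[cite: GreenbergLNM1716, Conj. 1.11 (p. 64) (shape)] -/
theorem katoMuPartAtTwo_of_g11Habitat (hG : G11HabitatText) (W : WeierstrassCurve ℚ) [W.IsElliptic]
    [W.IsGloballyMinimal] (hcm : ¬ W.HasCM) (hr : W.analyticRank = 0) (hgo : GoodOrd W 2)
    (h2 : W.HasSurjectiveModNGaloisRep 2) : O1.KatoMuPartAtTwo W :=
  O1.katoMuPartAtTwo_of_mu_eq_zero W (hG W hcm hr hgo h2)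

/-- **DIRECT ROAD, SIGN-FREE — line 2: + Abbes–Ullmo + Kato 17.4 (1)(2) AT `W` ⟹ `O1.MainConjectureLowerDivisibilityAtTwoOrd W`.**
No sign of `Δ`, no Euler system, no Coleman map, no Poitou–Tate. [cite: Kato2004Asterisque, Thm. 17.4 (1)(2) (p. 273)] [cite: AbbesUllmo1996, Thm. A] -/
theorem lowerDivisibility_of_g11Habitat (hG : G11HabitatText)
    (hAU : abbesUllmo_not_dvd_maninConstant_of_not_dvd_level) (W : WeierstrassCurve ℚ) [W.IsElliptic]
    [W.IsGloballyMinimal] (hcm : ¬ W.HasCM) (hr : W.analyticRank = 0) (hgo : GoodOrd W 2)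
    (h2 : W.HasSurjectiveModNGaloisRep 2)
    (h17 : ∀ [NeZero (W.conductorNorm ℤ)] (f : CuspForm (Gamma0 (W.conductorNorm ℤ)) 2),
      kato_divisibility_allPrimes W 2 (f := f)) :
    O1.MainConjectureLowerDivisibilityAtTwoOrd W := by
  haveI : NeZero ((2 : ℕ) : ℚ) := ⟨by norm_num⟩
  exact O1.mainConjectureLowerDivisibilityAtTwoOrd_of_katoMuPartAtTwo W h17
    (fun f hf ϖ hϖ => hint_two_of_abbesUllmo_of_irr hAU W hgo
      (hasIrreducibleModPGaloisRep_of_hasSurjectiveModNGaloisRep W 2 h2) f hf ϖ hϖ)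
    (katoMuPartAtTwo_of_g11Habitat hG W hcm hr hgo h2)

/-- **DIRECT ROAD, SIGN-FREE — line 3: the crux ON THE WHOLE ONTO CELL with `W' := W`** from {G11|habitat, AU, Kato 17.4 (1)(2)@2}.
[cite: Kato2004Asterisque, Thm. 17.4 (1)(2) (p. 273)] -/
theorem cruxOnto_of_g11Habitat (hG : G11HabitatText) (hAU : abbesUllmo_not_dvd_maninConstant_of_not_dvd_level)
    (h17 : ∀ (V : WeierstrassCurve ℚ) [V.IsElliptic] [V.IsGloballyMinimal] [NeZero (V.conductorNorm ℤ)]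
      (f : CuspForm (Gamma0 (V.conductorNorm ℤ)) 2), kato_divisibility_allPrimes V 2 (f := f)) :
    CruxOntoText :=
  fun W _ _ hcm hr hgo h2 =>
    ⟨W, ‹_›, ‹_›, isIsogenous_self W, lowerDivisibility_of_g11Habitat hG hAU W hcm hr hgo h2 (h17 W)⟩

/-- The same with Kato 17.4 (1)(2)@2 taken from PUB (`OrdPublishedInputsAtTwo`, conjunct 3). [cite: Kato2004Asterisque, Thm. 17.4 (1)(2) (p. 273)] -/
theorem cruxOnto_of_g11Habitat_of_pub (hG : G11HabitatText) (hPub : Literature.Uncategorized.OrdPublishedInputsAtTwo)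
    (hAU : abbesUllmo_not_dvd_maninConstant_of_not_dvd_level) : CruxOntoText := by
  obtain ⟨-, -, h17, -⟩ := hPub
  exact cruxOnto_of_g11Habitat hG hAU h17

/-- **NECESSITY, SIGN-FREE** (v24 §4 `greenbergMu_two_onto_necessary` / w3 GEN 7 §4, replayed by landed names): the crux on the onto cell ⟹
G11|habitat, granted PUB, Cassels, Abbes–Ullmo. [cite: GreenbergLNM1716, Conj. 1.11 (p. 64)] [cite: Kato2004Asterisque, Thm. 17.4 (1)(2) (p. 273)]
[cite: MilneADT2006, Thm. I.7.3 (Cassels)] [cite: AbbesUllmo1996, Thm. A] -/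
theorem g11Habitat_of_cruxOnto (hcrux : CruxOntoText) (hPub : Literature.Uncategorized.OrdPublishedInputsAtTwo)
    (hCassels : bsdRHS_eq_of_isIsogenous) (hAU : abbesUllmo_not_dvd_maninConstant_of_not_dvd_level) :
    G11HabitatText := by
  intro W _ _ hcm hr hgo h2 κ γ hκ hγ hγ' D
  obtain ⟨W', _, _, hiso, hK'⟩ := hcrux W hcm hr hgo h2
  have hP := hPub
  obtain ⟨hmod, -, h17, -⟩ := hP
  exact mu_eq_zero_of_katoMuPartAtTwo_of_irr W hAU hmod hgo
    (hasIrreducibleModPGaloisRep_of_hasSurjectiveModNGaloisRep W 2 h2)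
    (O1.katoMuPartAtTwo_of_mainConjectureLowerDivisibilityAtTwoOrd W (fun f ↦ h17 W f)
      (Summit.BirchSwinnertonDyer.BirchSwinnertonDyer.Theorems.IsogenyMuShift.katoHalf_isogenyInvariant hPub hCassels hiso
        hgo hr hK'))
    hκ hγ hγ' D

/-- **THE EQUIVALENCE ON THE ONTO CELL: crux|onto ⟺ G11|habitat, modulo {PUB, Abbes–Ullmo, Cassels}.**
[cite: GreenbergLNM1716, Conj. 1.11 (p. 64)] [cite: Kato2004Asterisque, Thm. 17.4 (1)(2) (p. 273)] -/
theorem cruxOnto_iff_g11Habitat (hPub : Literature.Uncategorized.OrdPublishedInputsAtTwo)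
    (hCassels : bsdRHS_eq_of_isIsogenous) (hAU : abbesUllmo_not_dvd_maninConstant_of_not_dvd_level) :
    CruxOntoText ↔ G11HabitatText :=
  ⟨fun h => g11Habitat_of_cruxOnto h hPub hCassels hAU, fun h => cruxOnto_of_g11Habitat_of_pub h hPub hAU⟩

/-- The route decl BY NAME restricts to the onto cell. [folklore] -/
theorem cruxOnto_of_crux (h : OrdKatoHalfAtTwoIso) : CruxOntoText :=
  fun W _ _ hcm hr hgo _ => h W hcm hr hgo

/-- **The route decl `OrdKatoHalfAtTwoIso` BY NAME from the two cell texts** (onto: G11|habitat's road above; not-onto: 23921's road). [folklore] -/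
theorem crux_of_onto_and_notOnto (h1 : CruxOntoText) (h2 : CruxNotOntoText) : OrdKatoHalfAtTwoIso := by
  intro W _ _ hcm hr hgo
  by_cases h : W.HasSurjectiveModNGaloisRep 2
  · exact h1 W hcm hr hgo h
  · exact h2 W hcm hr hgo h

/-- **v25-shape (display): G11⁺ (landed name) + G11⁻ (w3's text) + PUB + AU + the not-onto cell ⟹ the route decl.** No V♭⁻, no functional,
no Poitou–Tate, no Euler system on the critical path of the CRUX. [cite: GreenbergLNM1716, Conj. 1.11 (p. 64)] -/
theorem crux_of_g11Pos_g11Neg_pub_AU_notOnto (hP : GreenbergMuZeroTwoOrdPosDisc) (hN : G11NegText)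
    (hPub : Literature.Uncategorized.OrdPublishedInputsAtTwo) (hAU : abbesUllmo_not_dvd_maninConstant_of_not_dvd_level)
    (hno : CruxNotOntoText) : OrdKatoHalfAtTwoIso :=
  crux_of_onto_and_notOnto (cruxOnto_of_g11Habitat_of_pub (g11Habitat_of_pos_and_neg hP hN) hPub hAU) hno

end Summit.BirchSwinnertonDyer.BirchSwinnertonDyer.Cruxes.OrdKatoHalfAtTwoIso.TriageCert48d

end
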